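import Mathlib
import HarnessLib

/-!
# `WakeRatchet.TailRatchet` (stmt-NavierStokesRegularity-21808): the monotone structure of the truncated
# inviscid dyadic lattice — positivity, leading-edge envelope, one-way energy flux

Support file for the crux `TailRatchet` (route `WakeRatchet`; MODEL lattice ODEs of Tao 2016 §4 —
nothing here is a statement about the Navier–Stokes equations).  After the four reduction files
(`…LatticePeriod`, `…TruncationLimit`, `…TruncatedFlow`, `…InvariantBox`) the construction blocking
stmt-21808 (`DyadicScalarFronts`) is an invariant compact convex set of the one-period map of the
`K`-truncated dyadic lattice `Ż_n = Λ^{n-1} Z_{n-1}² − Λ^n Z_n Z_{n+1}` in a `K`-uniform box with a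
continuous flight-time section.  This file proves the three elementary structural facts from which such
boxes and sections are built (the beginning of the stub-A analogue):

* `truncated_nonneg` — POSITIVITY: non-negative data stay non-negative (each shell solves the linear
  equation `Ż_n = a_n − c_n Z_n` with source `a_n = Λ^{n-1}Z_{n-1}² ≥ 0`; integrating factor, no sign of
  `Z_{n+1}` needed);
* `truncated_le_feed` — LEADING-EDGE ENVELOPE: `Z_{n-1}² ≤ M` on `[0,t]` ⟹ `Z_n(t) ≤ Z_n(0) + Λ^{n-1} M t`
  (the drain is non-negative by positivity), the estimate that propagates the doubly-exponential
  smallness of the shells ahead of the front;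
* `truncated_lowEnergy_antitone` — ONE-WAY FLUX: the energy of the low part of the window
  `Σ_{-K ≤ n < N} Z_n²` is non-increasing (derivative `= −2Λ^{N-1}Z_{N-1}²Z_N ≤ 0`); with the exact
  conservation `truncated_energy_conserved` the energy above any cut is non-decreasing — the monotone
  CLOCK available for the flight-time section.

HONEST FRAMING: elementary facts about a finite-dimensional MODEL ODE; no registered stub is closed, no
summit statement is touched.
-/

noncomputable section

set_option linter.dupNamespace false

namespace Summit.NavierStokesRegularity.NavierStokesRegularity.Theorems

namespace WakeRatchetLatticePeriod

open Set Filter Topology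

/-- Every shell of a `K`-truncated solution is continuous on `[0, T']` (the frozen ones are `0`).
[elementary] -/
theorem truncated_continuousOn {L : ℝ} {K : ℕ} {T' : ℝ} {Z : ℤ → ℝ → ℝ}
    (hD : ∀ n : ℤ, |n| ≤ (K : ℤ) → ∀ t ∈ Icc (0 : ℝ) T', HasDerivWithinAt (Z n)
      (L ^ (n - 1) * Z (n - 1) t ^ 2 - L ^ n * Z n t * Z (n + 1) t) (Icc (0 : ℝ) T') t)
    (hzero : ∀ n : ℤ, (K : ℤ) < |n| → ∀ t ∈ Icc (0 : ℝ) T', Z n t = 0) (n : ℤ) :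
    ContinuousOn (Z n) (Icc (0 : ℝ) T') := by
  by_cases hn : |n| ≤ (K : ℤ)
  · exact fun t ht => (hD n hn t ht).continuousWithinAt
  · exact (continuousOn_const (c := (0 : ℝ))).congr fun t ht => hzero n (not_le.1 hn) t ht

/-- **Positivity of the truncated inviscid dyadic lattice.**  If the shells `|n| ≤ K` solve
`Ż_n = Λ^{n-1} Z_{n-1}² − Λ^n Z_n Z_{n+1}` on `[0, T']`, the others are frozen at `0`, and all shells
are non-negative at time `0`, then all shells stay non-negative on `[0, T']`: each shell obeys the LINEAR
equation `Ż_n = a_n − c_n Z_n` with the non-negative source `a_n = Λ^{n-1} Z_{n-1}²`, so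
`exp(∫c_n) Z_n` is non-decreasing (integrating factor; no sign information on `Z_{n+1}` is needed).
[cite: Tao2016AveragedNS, §1.2 (dyadic model); folklore (Cheskidov / Katz–Pavlović positivity)] -/
theorem truncated_nonneg {L : ℝ} {K : ℕ} {T' : ℝ} {Z : ℤ → ℝ → ℝ}
    (hD : ∀ n : ℤ, |n| ≤ (K : ℤ) → ∀ t ∈ Icc (0 : ℝ) T', HasDerivWithinAt (Z n)
      (L ^ (n - 1) * Z (n - 1) t ^ 2 - L ^ n * Z n t * Z (n + 1) t) (Icc (0 : ℝ) T') t)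
    (hzero : ∀ n : ℤ, (K : ℤ) < |n| → ∀ t ∈ Icc (0 : ℝ) T', Z n t = 0)
    (hL : 0 ≤ L) (h0 : ∀ n : ℤ, 0 ≤ Z n 0) (n : ℤ) :
    ∀ t ∈ Icc (0 : ℝ) T', 0 ≤ Z n t := by
  intro t ht
  by_cases hn : |n| ≤ (K : ℤ)
  swap
  · exact (hzero n (not_le.1 hn) t ht).symm.le
  have h0T : (0 : ℝ) ≤ T' := ht.1.trans ht.2
  -- the drain coefficient, extended continuously to `ℝ`, and its primitive
  have hcZ := truncated_continuousOn hD hzero (n + 1)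
  set c : ℝ → ℝ := fun s => L ^ n * Z (n + 1) (projIcc (0 : ℝ) T' h0T s) with hc
  have hcc : Continuous c :=
    continuous_const.mul ((continuousOn_iff_continuous_restrict.1 hcZ).comp continuous_projIcc)
  have hcI : ∀ s ∈ Icc (0 : ℝ) T', c s = L ^ n * Z (n + 1) s := fun s hs => by
    simp only [hc, projIcc_of_mem h0T hs]
  set P : ℝ → ℝ := fun u => ∫ s in (0 : ℝ)..u, c s with hP
  have hPd : ∀ u, HasDerivAt P (c u) u := fun u =>
    (hcc.integral_hasStrictDerivAt 0 u).hasDerivAt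
  -- the integrating factor: `ψ = exp(P) · Z_n` is non-decreasing on `[0, T']`
  set ψ : ℝ → ℝ := fun u => Real.exp (P u) * Z n u with hψ
  have hψd : ∀ u ∈ Icc (0 : ℝ) T', HasDerivWithinAt ψ
      (Real.exp (P u) * (L ^ (n - 1) * Z (n - 1) u ^ 2)) (Icc (0 : ℝ) T') u := by
    intro u hu
    have h1 : HasDerivWithinAt (fun u => Real.exp (P u)) (Real.exp (P u) * c u) (Icc (0 : ℝ) T') u :=
      ((hPd u).exp).hasDerivWithinAt
    have h2 := h1.mul (hD n hn u hu)
    refine h2.congr_deriv ?_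
    rw [hcI u hu]
    ring
  have hmono : MonotoneOn ψ (Icc (0 : ℝ) T') := by
    refine monotoneOn_of_hasDerivWithinAt_nonneg (f' := fun u => Real.exp (P u) * (L ^ (n - 1) * Z (n - 1) u ^ 2))
      (convex_Icc 0 T') (fun u hu => (hψd u hu).continuousWithinAt) (fun u hu => ?_) (fun u hu => ?_)
    · rw [interior_Icc] at hu ⊢
      exact (hψd u (Ioo_subset_Icc_self hu)).mono Ioo_subset_Icc_self
    · rw [interior_Icc] at hu
      have : 0 ≤ L ^ (n - 1) := zpow_nonneg hL _
      positivity
  have hψ0 : 0 ≤ ψ 0 := by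
    simp only [hψ, hP, intervalIntegral.integral_same, Real.exp_zero, one_mul]
    exact h0 n
  have hψt : 0 ≤ ψ t := hψ0.trans (hmono ⟨le_rfl, h0T⟩ ht ht.1)
  exact (mul_nonneg_iff_of_pos_left (Real.exp_pos (P t))).1 hψt

/-- **Leading-edge envelope.**  With non-negative data, a shell of the truncated lattice grows at most by
the feed it receives: if `Z_{n-1}² ≤ M` on `[0, t]` then `Z_n(t) ≤ Z_n(0) + Λ^{n-1} M t` (drop the
non-negative drain `Λ^n Z_n Z_{n+1}`; the function `Z_n(u) − Λ^{n-1} M u` is non-increasing).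
[cite: Tao2016AveragedNS, §1.2; elementary] -/
theorem truncated_le_feed {L : ℝ} {K : ℕ} {T' : ℝ} {Z : ℤ → ℝ → ℝ}
    (hD : ∀ n : ℤ, |n| ≤ (K : ℤ) → ∀ t ∈ Icc (0 : ℝ) T', HasDerivWithinAt (Z n)
      (L ^ (n - 1) * Z (n - 1) t ^ 2 - L ^ n * Z n t * Z (n + 1) t) (Icc (0 : ℝ) T') t)
    (hzero : ∀ n : ℤ, (K : ℤ) < |n| → ∀ t ∈ Icc (0 : ℝ) T', Z n t = 0)
    (hL : 0 ≤ L) (h0 : ∀ n : ℤ, 0 ≤ Z n 0) (n : ℤ) {t M : ℝ} (ht : t ∈ Icc (0 : ℝ) T')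
    (hM : ∀ s ∈ Icc (0 : ℝ) t, Z (n - 1) s ^ 2 ≤ M) :
    Z n t ≤ Z n 0 + L ^ (n - 1) * M * t := by
  have hM0 : 0 ≤ M := (sq_nonneg _).trans (hM 0 ⟨le_rfl, ht.1⟩)
  have hLn : 0 ≤ L ^ (n - 1) := zpow_nonneg hL _
  by_cases hn : |n| ≤ (K : ℤ)
  swap
  · rw [hzero n (not_le.1 hn) t ht, hzero n (not_le.1 hn) 0 ⟨le_rfl, ht.1.trans ht.2⟩, zero_add]
    exact mul_nonneg (mul_nonneg hLn hM0) ht.1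
  have hsub : Icc (0 : ℝ) t ⊆ Icc (0 : ℝ) T' := Icc_subset_Icc_right ht.2
  set w : ℝ → ℝ := fun u => Z n u - L ^ (n - 1) * M * u with hw
  have hwd : ∀ u ∈ Icc (0 : ℝ) t, HasDerivWithinAt w
      (L ^ (n - 1) * Z (n - 1) u ^ 2 - L ^ n * Z n u * Z (n + 1) u - L ^ (n - 1) * M) (Icc (0 : ℝ) t) u := by
    intro u hu
    have h1 := ((hD n hn u (hsub hu)).mono hsub)
    have h2 : HasDerivWithinAt (fun u => L ^ (n - 1) * M * u) (L ^ (n - 1) * M) (Icc (0 : ℝ) t) u := by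
      simpa using ((hasDerivAt_id u).const_mul (L ^ (n - 1) * M)).hasDerivWithinAt
    exact h1.sub h2
  have hanti : AntitoneOn w (Icc (0 : ℝ) t) := by
    refine antitoneOn_of_hasDerivWithinAt_nonpos
      (f' := fun u => L ^ (n - 1) * Z (n - 1) u ^ 2 - L ^ n * Z n u * Z (n + 1) u - L ^ (n - 1) * M)
      (convex_Icc 0 t) (fun u hu => (hwd u hu).continuousWithinAt) (fun u hu => ?_) (fun u hu => ?_)
    · rw [interior_Icc] at hu ⊢
      exact (hwd u (Ioo_subset_Icc_self hu)).mono Ioo_subset_Icc_self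
    · rw [interior_Icc] at hu
      have hu' : u ∈ Icc (0 : ℝ) t := Ioo_subset_Icc_self hu
      have hZn : 0 ≤ Z n u := truncated_nonneg hD hzero hL h0 n u (hsub hu')
      have hZp : 0 ≤ Z (n + 1) u := truncated_nonneg hD hzero hL h0 (n + 1) u (hsub hu')
      have hdrain : 0 ≤ L ^ n * Z n u * Z (n + 1) u := mul_nonneg (mul_nonneg (zpow_nonneg hL _) hZn) hZp
      have hfeed : L ^ (n - 1) * Z (n - 1) u ^ 2 ≤ L ^ (n - 1) * M :=
        mul_le_mul_of_nonneg_left (hM u hu') hLn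
      linarith
  have := hanti ⟨le_rfl, ht.1⟩ ⟨ht.1, le_rfl⟩ ht.1
  simp only [hw, mul_zero, sub_zero] at this
  linarith

/-- **The one-way energy flux (clock).**  With non-negative data, the energy of the LOW part of the
window, `Σ_{j < i} Z_{j-K}²` (shells `-K ≤ n < i - K`), is non-increasing in time: its derivative is
minus twice the flux `Λ^{i-1-K} Z_{i-1-K}² Z_{i-K} ≥ 0` into the shell `i - K` (the fluxes inside the
block telescope; nothing enters from below the window).  By `truncated_energy_conserved` the energy of
the complementary HIGH part is then non-decreasing — the natural monotone clock of the front.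
[cite: Tao2016AveragedNS, §1.2 (energy transfer of the dyadic model); elementary] -/
theorem truncated_lowEnergy_antitone {L : ℝ} {K : ℕ} {T' : ℝ} {Z : ℤ → ℝ → ℝ}
    (hD : ∀ n : ℤ, |n| ≤ (K : ℤ) → ∀ t ∈ Icc (0 : ℝ) T', HasDerivWithinAt (Z n)
      (L ^ (n - 1) * Z (n - 1) t ^ 2 - L ^ n * Z n t * Z (n + 1) t) (Icc (0 : ℝ) T') t)
    (hzero : ∀ n : ℤ, (K : ℤ) < |n| → ∀ t ∈ Icc (0 : ℝ) T', Z n t = 0)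
    (hL : 0 ≤ L) (h0 : ∀ n : ℤ, 0 ≤ Z n 0) {i : ℕ} (hi : i ≤ 2 * K + 1) :
    AntitoneOn (fun t => ∑ j ∈ Finset.range i, Z ((j : ℤ) - K) t ^ 2) (Icc (0 : ℝ) T') := by
  have hmemK : ∀ j ∈ Finset.range i, |((j : ℤ) - K)| ≤ (K : ℤ) := by
    intro j hj
    rw [Finset.mem_range] at hj
    rw [abs_le]; constructor <;> omega
  -- derivative of the low energy: minus twice the flux into shell `i - K`
  have hderiv : ∀ t ∈ Icc (0 : ℝ) T', HasDerivWithinAt (fun t => ∑ j ∈ Finset.range i, Z ((j : ℤ) - K) t ^ 2)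
      (-(2 * (L ^ ((i : ℤ) - K - 1) * Z ((i : ℤ) - K - 1) t ^ 2 * Z ((i : ℤ) - K) t))) (Icc (0 : ℝ) T') t := by
    intro t ht
    set φ : ℤ → ℝ := fun n => L ^ n * Z n t ^ 2 * Z (n + 1) t with hφ
    have hsum : HasDerivWithinAt (fun t => ∑ j ∈ Finset.range i, Z ((j : ℤ) - K) t ^ 2)
        (∑ j ∈ Finset.range i, 2 * (φ (((j : ℤ) - K) - 1) - φ ((j : ℤ) - K))) (Icc (0 : ℝ) T') t := by
      have := HasDerivWithinAt.sum (u := Finset.range i)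
        (A := fun j s => Z ((j : ℤ) - K) s ^ 2)
        (A' := fun j => 2 * (φ (((j : ℤ) - K) - 1) - φ ((j : ℤ) - K))) (x := t) (s := Icc (0 : ℝ) T')
        (fun j hj => by
          have h := (hD _ (hmemK j hj) t ht).pow 2
          refine h.congr_deriv ?_
          simp only [hφ]
          push_cast
          ring_nf)
      simpa only [Finset.sum_fn] using this
    have htel : ∑ j ∈ Finset.range i, 2 * (φ (((j : ℤ) - K) - 1) - φ ((j : ℤ) - K))
        = -(2 * (L ^ ((i : ℤ) - K - 1) * Z ((i : ℤ) - K - 1) t ^ 2 * Z ((i : ℤ) - K) t)) := by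
      have h1 : ∑ j ∈ Finset.range i, 2 * (φ (((j : ℤ) - K) - 1) - φ ((j : ℤ) - K))
          = -(2 * ∑ j ∈ Finset.range i, (φ (((j + 1 : ℕ) : ℤ) - K - 1) - φ ((j : ℤ) - K - 1))) := by
        rw [Finset.mul_sum, ← Finset.sum_neg_distrib]
        refine Finset.sum_congr rfl fun j _ => ?_
        push_cast
        ring_nf
      rw [h1, Finset.sum_range_sub (fun j => φ ((j : ℤ) - K - 1))]
      have hbot : φ (((0 : ℕ) : ℤ) - K - 1) = 0 := by
        simp only [hφ]
        rw [hzero (((0 : ℕ) : ℤ) - K - 1) (by push_cast; rw [abs_of_nonpos] <;> omega) t ht]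
        ring
      rw [hbot, sub_zero]
      simp only [hφ, sub_add_cancel]
    rw [htel] at hsum
    exact hsum
  refine antitoneOn_of_hasDerivWithinAt_nonpos
    (f' := fun t => -(2 * (L ^ ((i : ℤ) - K - 1) * Z ((i : ℤ) - K - 1) t ^ 2 * Z ((i : ℤ) - K) t)))
    (convex_Icc 0 T') (fun t ht => (hderiv t ht).continuousWithinAt) (fun t ht => ?_) (fun t ht => ?_)
  · rw [interior_Icc] at ht ⊢
    exact (hderiv t (Ioo_subset_Icc_self ht)).mono Ioo_subset_Icc_self
  · rw [interior_Icc] at ht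
    have hZ : 0 ≤ Z ((i : ℤ) - K) t := truncated_nonneg hD hzero hL h0 _ t (Ioo_subset_Icc_self ht)
    have : 0 ≤ L ^ ((i : ℤ) - K - 1) * Z ((i : ℤ) - K - 1) t ^ 2 * Z ((i : ℤ) - K) t :=
      mul_nonneg (mul_nonneg (zpow_nonneg hL _) (sq_nonneg _)) hZ
    linarith

end WakeRatchetLatticePeriod

end Summit.NavierStokesRegularity.NavierStokesRegularity.Theorems

end
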